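import Summits.CriticalPhenomena.PercolationContinuityZ3.Theorems.PercNearOneGluingNoHeavyPcintMemUniformSixTables
import Summits.CriticalPhenomena.PercolationContinuityZ3.Theorems.PercNearOneGluingNoHeavyPcintClosingCountKernelZ2
import HarnessLib

/-!
# CriticalPhenomena/PercolationContinuityZ3 — Theorems/PercNearOneGluingNoHeavyPcintClosingHexagonsExact.lean: the hexagon count of `ℤ^d` for EVERY `d`: `2·6·p_6(ℤ^d) = 4d(d−1)(8d−13)`, i.e. `p_6(ℤ^d) = d(d−1)(8d−13)/3`

Lane prim-pcint, STRUCTURE rule (prim-pcint-2 GEN 18).  The tree has the closing count `closingCount d 6 = 2·6·p_6(ℤ^d)` (number of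
5-step self-avoiding words ending next to their start) by kernel evaluation for `d = 2, 3, 4` (…ClosingCountKernel(Z2): 24, 264, 912)
and the LOWER bound `4(2d)(2d−2)(2d−4) + 3(2d)(2d−2) ≤ closingCount d 6` for all `d` by seven injective families (…ClosingHexagons).
EQUALITY for every `d` needs the classification of ALL closing words; here it comes for free from the dimension-uniform class
automaton: `closingCount d 6 = cntP (mstep 6) (age 5 present) ∅ 5` (…ClosingCountKernel) `= cntP (uistep scert_d4t6 d) … 0 5`
(…PcintMemUniform, `d ≥ 4`), and the five steps of the first-letter recursion `cntP_{k+1}(i) = base_i(cntP_k) + (d−4)·fresh_i(cntP_k)`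
(…PcintMemUniformBounds) are evaluated SYMBOLICALLY in `d` from the successor tables of …PcintMemUniformSixTables (`hexc_k_i`,
generated by numerics/gen_u4.py of the seat folder; only the rows reachable in `5 − k` letters are needed).  Results:

* **`closingCount_six_eq_real`** (`d ≥ 4`): `(closingCount d 6 : ℝ) = 32d³ − 84d² + 52d`;
* **`closingCount_six_eq`**: `closingCount d 6 = 4·d·(d−1)·(8d−13)` for EVERY `d ≥ 2` (d = 2, 3 from the kernel files);
  so `p_6(ℤ^d) = d(d−1)(8d−13)/3` (22, 76, 195, 400, … for d = 3, 4, 5, 6), the equality case of `closingCount_six_ge`, and the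
  second-rung density `f_6(d) = 4d(d−1)(8d−13)/μ_4(d)⁶` is now available two-sided in every dimension (…LoopExclusionRungSixDimension).

HONEST FRAMING: a finite symbolic evaluation; elementary.  No `sorry`; standard axioms.  Written by prim-pcint-2 gen 18
(prover-prim-pcint-2-g18-0), 2026-08-26.
-/

noncomputable section

open Literature.Probability.Percolation Literature.Probability.LatticeModels

namespace Summit.CriticalPhenomena.PercolationContinuityZ3.Theorems.Pcint

/-- The final-state predicate "an entry of age `5` is present", read on the rows of `scert_d4t6`. [folklore] -/
def hexP (i : ℕ) : Prop := HasAge 5 (sstOf scert_d4t6 i)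

/-- `hexP` is decidable. [folklore] -/
instance : DecidablePred hexP := fun i => by unfold hexP; infer_instance

/-- Shorthand for the level-`k` counts of the uniform index automaton with the age-5 predicate, as reals. [folklore] -/
def hexc (d i k : ℕ) : ℝ := (cntP (uistep scert_d4t6 d) hexP i k : ℝ)

/-- The recursion of `hexc` in closed form on the tables. [folklore] -/
theorem hexc_succ {d : ℕ} (hd : 4 ≤ d) (i k : ℕ) :
    hexc d i (k + 1) = (((baseIdx scert_d4t6 i).map (optValR fun j => hexc d j k)).sum) +
      ((d : ℝ) - 4) * (((freshIdx scert_d4t6 i).map (optValR fun j => hexc d j k)).sum) := by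
  unfold hexc
  rw [cntP_uistep_succ_real _ hd, baseSum_eq, freshSum_eq]


/-! ### Level 0: which rows carry an age-5 entry -/

/-- Level-0 value of row 4. [folklore] -/
theorem hexc_0_4 (d : ℕ) : hexc d 4 0 = 0 := by
  have h : ¬ hexP 4 := by decide
  simp [hexc, cntP, h]

/-- Level-0 value of row 5. [folklore] -/
theorem hexc_0_5 (d : ℕ) : hexc d 5 0 = 0 := by
  have h : ¬ hexP 5 := by decide
  simp [hexc, cntP, h]

/-- Level-0 value of row 6. [folklore] -/
theorem hexc_0_6 (d : ℕ) : hexc d 6 0 = 0 := by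
  have h : ¬ hexP 6 := by decide
  simp [hexc, cntP, h]

/-- Level-0 value of row 7. [folklore] -/
theorem hexc_0_7 (d : ℕ) : hexc d 7 0 = 0 := by
  have h : ¬ hexP 7 := by decide
  simp [hexc, cntP, h]

/-- Level-0 value of row 9. [folklore] -/
theorem hexc_0_9 (d : ℕ) : hexc d 9 0 = 0 := by
  have h : ¬ hexP 9 := by decide
  simp [hexc, cntP, h]

/-- Level-0 value of row 10. [folklore] -/
theorem hexc_0_10 (d : ℕ) : hexc d 10 0 = 0 := by
  have h : ¬ hexP 10 := by decide
  simp [hexc, cntP, h]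

/-- Level-0 value of row 11. [folklore] -/
theorem hexc_0_11 (d : ℕ) : hexc d 11 0 = 0 := by
  have h : ¬ hexP 11 := by decide
  simp [hexc, cntP, h]

/-- Level-0 value of row 12. [folklore] -/
theorem hexc_0_12 (d : ℕ) : hexc d 12 0 = 0 := by
  have h : ¬ hexP 12 := by decide
  simp [hexc, cntP, h]

/-- Level-0 value of row 13. [folklore] -/
theorem hexc_0_13 (d : ℕ) : hexc d 13 0 = 0 := by
  have h : ¬ hexP 13 := by decide
  simp [hexc, cntP, h]

/-- Level-0 value of row 14. [folklore] -/
theorem hexc_0_14 (d : ℕ) : hexc d 14 0 = 0 := by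
  have h : ¬ hexP 14 := by decide
  simp [hexc, cntP, h]

/-- Level-0 value of row 15. [folklore] -/
theorem hexc_0_15 (d : ℕ) : hexc d 15 0 = 0 := by
  have h : ¬ hexP 15 := by decide
  simp [hexc, cntP, h]

/-- Level-0 value of row 16. [folklore] -/
theorem hexc_0_16 (d : ℕ) : hexc d 16 0 = 0 := by
  have h : ¬ hexP 16 := by decide
  simp [hexc, cntP, h]

/-- Level-0 value of row 17. [folklore] -/
theorem hexc_0_17 (d : ℕ) : hexc d 17 0 = 0 := by
  have h : ¬ hexP 17 := by decide
  simp [hexc, cntP, h]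

/-- Level-0 value of row 18. [folklore] -/
theorem hexc_0_18 (d : ℕ) : hexc d 18 0 = 1 := by
  have h : hexP 18 := by decide
  simp [hexc, cntP, h]

/-- Level-0 value of row 19. [folklore] -/
theorem hexc_0_19 (d : ℕ) : hexc d 19 0 = 1 := by
  have h : hexP 19 := by decide
  simp [hexc, cntP, h]

/-- Level-0 value of row 20. [folklore] -/
theorem hexc_0_20 (d : ℕ) : hexc d 20 0 = 1 := by
  have h : hexP 20 := by decide
  simp [hexc, cntP, h]

/-- Level-0 value of row 21. [folklore] -/
theorem hexc_0_21 (d : ℕ) : hexc d 21 0 = 1 := by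
  have h : hexP 21 := by decide
  simp [hexc, cntP, h]

/-- Level-0 value of row 22. [folklore] -/
theorem hexc_0_22 (d : ℕ) : hexc d 22 0 = 1 := by
  have h : hexP 22 := by decide
  simp [hexc, cntP, h]

/-- Level-0 value of row 23. [folklore] -/
theorem hexc_0_23 (d : ℕ) : hexc d 23 0 = 1 := by
  have h : hexP 23 := by decide
  simp [hexc, cntP, h]

/-- Level-0 value of row 24. [folklore] -/
theorem hexc_0_24 (d : ℕ) : hexc d 24 0 = 1 := by
  have h : hexP 24 := by decide
  simp [hexc, cntP, h]

/-! ### Level 1 -/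

/-- Level-1 value of row 4 (polynomial in `d`). [folklore] -/
theorem hexc_1_4 {d : ℕ} (hd : 4 ≤ d) : hexc d 4 1 = 0 := by
  rw [hexc_succ hd, baseIdx_d4t6_4, freshIdx_d4t6_4]
  simp only [List.map, optValR, List.sum_cons, List.sum_nil, hexc_0_4 d, hexc_0_5 d]
  ring

/-- Level-1 value of row 5 (polynomial in `d`). [folklore] -/
theorem hexc_1_5 {d : ℕ} (hd : 4 ≤ d) : hexc d 5 1 = 0 := by
  rw [hexc_succ hd, baseIdx_d4t6_5, freshIdx_d4t6_5]
  simp only [List.map, optValR, List.sum_cons, List.sum_nil, hexc_0_6 d, hexc_0_7 d, hexc_0_9 d, hexc_0_10 d]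
  ring

/-- Level-1 value of row 6 (polynomial in `d`). [folklore] -/
theorem hexc_1_6 {d : ℕ} (hd : 4 ≤ d) : hexc d 6 1 = 0 := by
  rw [hexc_succ hd, baseIdx_d4t6_6, freshIdx_d4t6_6]
  simp only [List.map, optValR, List.sum_cons, List.sum_nil, hexc_0_4 d, hexc_0_5 d, hexc_0_11 d]
  ring

/-- Level-1 value of row 7 (polynomial in `d`). [folklore] -/
theorem hexc_1_7 {d : ℕ} (hd : 4 ≤ d) : hexc d 7 1 = 0 := by
  rw [hexc_succ hd, baseIdx_d4t6_7, freshIdx_d4t6_7]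
  simp only [List.map, optValR, List.sum_cons, List.sum_nil, hexc_0_6 d, hexc_0_7 d, hexc_0_9 d, hexc_0_12 d]
  ring

/-- Level-1 value of row 9 (polynomial in `d`). [folklore] -/
theorem hexc_1_9 {d : ℕ} (hd : 4 ≤ d) : hexc d 9 1 = 0 := by
  rw [hexc_succ hd, baseIdx_d4t6_9, freshIdx_d4t6_9]
  simp only [List.map, optValR, List.sum_cons, List.sum_nil, hexc_0_6 d, hexc_0_7 d, hexc_0_9 d, hexc_0_16 d, hexc_0_17 d]
  ring

/-- Level-1 value of row 10 (polynomial in `d`). [folklore] -/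
theorem hexc_1_10 {d : ℕ} (hd : 4 ≤ d) : hexc d 10 1 = 1 := by
  rw [hexc_succ hd, baseIdx_d4t6_10, freshIdx_d4t6_10]
  simp only [List.map, optValR, List.sum_cons, List.sum_nil, hexc_0_14 d, hexc_0_15 d, hexc_0_18 d]
  ring

/-- Level-1 value of row 11 (polynomial in `d`). [folklore] -/
theorem hexc_1_11 {d : ℕ} (hd : 4 ≤ d) : hexc d 11 1 = 1 := by
  rw [hexc_succ hd, baseIdx_d4t6_11, freshIdx_d4t6_11]
  simp only [List.map, optValR, List.sum_cons, List.sum_nil, hexc_0_6 d, hexc_0_7 d, hexc_0_9 d, hexc_0_19 d]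
  ring

/-- Level-1 value of row 12 (polynomial in `d`). [folklore] -/
theorem hexc_1_12 {d : ℕ} (hd : 4 ≤ d) : hexc d 12 1 = 0 := by
  rw [hexc_succ hd, baseIdx_d4t6_12, freshIdx_d4t6_12]
  simp only [List.map, optValR, List.sum_cons, List.sum_nil, hexc_0_13 d, hexc_0_14 d, hexc_0_15 d]
  ring

/-- Level-1 value of row 13 (polynomial in `d`). [folklore] -/
theorem hexc_1_13 {d : ℕ} (hd : 4 ≤ d) : hexc d 13 1 = 1 := by
  rw [hexc_succ hd, baseIdx_d4t6_13, freshIdx_d4t6_13]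
  simp only [List.map, optValR, List.sum_cons, List.sum_nil, hexc_0_4 d, hexc_0_5 d, hexc_0_20 d]
  ring

/-- Level-1 value of row 14 (polynomial in `d`). [folklore] -/
theorem hexc_1_14 {d : ℕ} (hd : 4 ≤ d) : hexc d 14 1 = 0 := by
  rw [hexc_succ hd, baseIdx_d4t6_14, freshIdx_d4t6_14]
  simp only [List.map, optValR, List.sum_cons, List.sum_nil, hexc_0_6 d, hexc_0_7 d, hexc_0_9 d, hexc_0_12 d]
  ring

/-- Level-1 value of row 15 (polynomial in `d`). [folklore] -/
theorem hexc_1_15 {d : ℕ} (hd : 4 ≤ d) : hexc d 15 1 = 1 := by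
  rw [hexc_succ hd, baseIdx_d4t6_15, freshIdx_d4t6_15]
  simp only [List.map, optValR, List.sum_cons, List.sum_nil, hexc_0_6 d, hexc_0_7 d, hexc_0_9 d, hexc_0_16 d, hexc_0_21 d]
  ring

/-- Level-1 value of row 16 (polynomial in `d`). [folklore] -/
theorem hexc_1_16 {d : ℕ} (hd : 4 ≤ d) : hexc d 16 1 = 1 := by
  rw [hexc_succ hd, baseIdx_d4t6_16, freshIdx_d4t6_16]
  simp only [List.map, optValR, List.sum_cons, List.sum_nil, hexc_0_13 d, hexc_0_14 d, hexc_0_15 d, hexc_0_22 d]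
  ring

/-- Level-1 value of row 17 (polynomial in `d`). [folklore] -/
theorem hexc_1_17 {d : ℕ} (hd : 4 ≤ d) : hexc d 17 1 = 2 := by
  rw [hexc_succ hd, baseIdx_d4t6_17, freshIdx_d4t6_17]
  simp only [List.map, optValR, List.sum_cons, List.sum_nil, hexc_0_6 d, hexc_0_7 d, hexc_0_9 d, hexc_0_23 d, hexc_0_24 d]
  ring

/-! ### Level 2 -/

/-- Level-2 value of row 4 (polynomial in `d`). [folklore] -/
theorem hexc_2_4 {d : ℕ} (hd : 4 ≤ d) : hexc d 4 2 = 0 := by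
  rw [hexc_succ hd, baseIdx_d4t6_4, freshIdx_d4t6_4]
  simp only [List.map, optValR, List.sum_cons, List.sum_nil, hexc_1_4 hd, hexc_1_5 hd]
  ring

/-- Level-2 value of row 5 (polynomial in `d`). [folklore] -/
theorem hexc_2_5 {d : ℕ} (hd : 4 ≤ d) : hexc d 5 2 = 1 := by
  rw [hexc_succ hd, baseIdx_d4t6_5, freshIdx_d4t6_5]
  simp only [List.map, optValR, List.sum_cons, List.sum_nil, hexc_1_6 hd, hexc_1_7 hd, hexc_1_9 hd, hexc_1_10 hd]
  ring

/-- Level-2 value of row 6 (polynomial in `d`). [folklore] -/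
theorem hexc_2_6 {d : ℕ} (hd : 4 ≤ d) : hexc d 6 2 = 1 := by
  rw [hexc_succ hd, baseIdx_d4t6_6, freshIdx_d4t6_6]
  simp only [List.map, optValR, List.sum_cons, List.sum_nil, hexc_1_4 hd, hexc_1_5 hd, hexc_1_11 hd]
  ring

/-- Level-2 value of row 7 (polynomial in `d`). [folklore] -/
theorem hexc_2_7 {d : ℕ} (hd : 4 ≤ d) : hexc d 7 2 = 0 := by
  rw [hexc_succ hd, baseIdx_d4t6_7, freshIdx_d4t6_7]
  simp only [List.map, optValR, List.sum_cons, List.sum_nil, hexc_1_6 hd, hexc_1_7 hd, hexc_1_9 hd, hexc_1_12 hd]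
  ring

/-- Level-2 value of row 8 (polynomial in `d`). [folklore] -/
theorem hexc_2_8 {d : ℕ} (hd : 4 ≤ d) : hexc d 8 2 = -3 + 2 * (d : ℝ) := by
  rw [hexc_succ hd, baseIdx_d4t6_8, freshIdx_d4t6_8]
  simp only [List.map, optValR, List.sum_cons, List.sum_nil, hexc_1_13 hd, hexc_1_14 hd, hexc_1_15 hd]
  ring

/-- Level-2 value of row 9 (polynomial in `d`). [folklore] -/
theorem hexc_2_9 {d : ℕ} (hd : 4 ≤ d) : hexc d 9 2 = 3 := by
  rw [hexc_succ hd, baseIdx_d4t6_9, freshIdx_d4t6_9]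
  simp only [List.map, optValR, List.sum_cons, List.sum_nil, hexc_1_6 hd, hexc_1_7 hd, hexc_1_9 hd, hexc_1_16 hd, hexc_1_17 hd]
  ring

/-! ### Level 3 -/

/-- Level-3 value of row 2 (polynomial in `d`). [folklore] -/
theorem hexc_3_2 {d : ℕ} (hd : 4 ≤ d) : hexc d 2 3 = -2 + 2 * (d : ℝ) := by
  rw [hexc_succ hd, baseIdx_d4t6_2, freshIdx_d4t6_2]
  simp only [List.map, optValR, List.sum_cons, List.sum_nil, hexc_2_4 hd, hexc_2_5 hd]
  ring

/-- Level-3 value of row 3 (polynomial in `d`). [folklore] -/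
theorem hexc_3_3 {d : ℕ} (hd : 4 ≤ d) : hexc d 3 3 = -14 + 8 * (d : ℝ) := by
  rw [hexc_succ hd, baseIdx_d4t6_3, freshIdx_d4t6_3]
  simp only [List.map, optValR, List.sum_cons, List.sum_nil, hexc_2_6 hd, hexc_2_7 hd, hexc_2_8 hd, hexc_2_9 hd]
  ring

/-! ### Level 4 -/

/-- Level-4 value of row 1 (polynomial in `d`). [folklore] -/
theorem hexc_4_1 {d : ℕ} (hd : 4 ≤ d) : hexc d 1 4 = 26 - 42 * (d : ℝ) + 16 * (d : ℝ) ^ 2 := by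
  rw [hexc_succ hd, baseIdx_d4t6_1, freshIdx_d4t6_1]
  simp only [List.map, optValR, List.sum_cons, List.sum_nil, hexc_3_2 hd, hexc_3_3 hd]
  ring

/-! ### Level 5 -/

/-- Level-5 value of row 0 (polynomial in `d`). [folklore] -/
theorem hexc_5_0 {d : ℕ} (hd : 4 ≤ d) : hexc d 0 5 = 52 * (d : ℝ) - 84 * (d : ℝ) ^ 2 + 32 * (d : ℝ) ^ 3 := by
  rw [hexc_succ hd, baseIdx_d4t6_0, freshIdx_d4t6_0]
  simp only [List.map, optValR, List.sum_cons, List.sum_nil, hexc_4_1 hd]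
  ring

/-! ### The hexagon count in every dimension -/

/-- **`(closingCount d 6 : ℝ) = 32d³ − 84d² + 52d`** for `d ≥ 4` (the uniform automaton, five symbolic steps). [folklore] -/
theorem closingCount_six_eq_real {d : ℕ} (hd : 4 ≤ d) :
    (MemoryTail.closingCount d 6 : ℝ) = 52 * (d : ℝ) - 84 * (d : ℝ) ^ 2 + 32 * (d : ℝ) ^ 3 := by
  rw [closingCount_eq_cntP (by norm_num) d, show (6 : ℕ) - 1 = 5 from rfl,
    cntP_mstep_eq_cntP_uistep hd ustruct_d4t6 usupp_d4t6 5 5]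
  exact hexc_5_0 hd

/-- **`closingCount d 6 = 4·d·(d−1)·(8d−13)` for every `d ≥ 2`**: the number of 5-step self-avoiding words of `ℤ^d` ending next
to their start, i.e. `2·6·p_6(ℤ^d)` with `p_6(ℤ^d) = d(d−1)(8d−13)/3` hexagons per site (`d = 2, 3`: kernel; `d ≥ 4`: the uniform
class automaton). [folklore] -/
theorem closingCount_six_eq {d : ℕ} (hd : 2 ≤ d) : MemoryTail.closingCount d 6 = 4 * d * (d - 1) * (8 * d - 13) := by
  rcases Nat.lt_or_ge d 4 with h | h
  · interval_cases d
    · rw [closingCount_six_zd2]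
    · rw [closingCount_six_zd3]
  · have hr := closingCount_six_eq_real h
    have h1 : ((4 * d * (d - 1) * (8 * d - 13) : ℕ) : ℝ) = 52 * (d : ℝ) - 84 * (d : ℝ) ^ 2 + 32 * (d : ℝ) ^ 3 := by
      rw [Nat.cast_mul, Nat.cast_mul, Nat.cast_mul, Nat.cast_sub (by omega), Nat.cast_sub (by omega)]
      push_cast
      ring
    exact_mod_cast hr.trans h1.symm

/-- **`2·6·p_6(ℤ^d) = 4(2d)(2d−2)(2d−4) + 3(2d)(2d−2)`**: the lower bound `closingCount_six_ge` of …ClosingHexagons (seven shapes)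
is an EQUALITY in every dimension `d ≥ 2`. [folklore] -/
theorem closingCount_six_eq' {d : ℕ} (hd : 2 ≤ d) :
    MemoryTail.closingCount d 6 = 4 * (2 * d * (2 * d - 2) * (2 * d - 4)) + 3 * (2 * d * (2 * d - 2)) := by
  rw [closingCount_six_eq hd]
  obtain ⟨e, rfl⟩ : ∃ e, d = e + 2 := ⟨d - 2, by omega⟩
  have h1 : e + 2 - 1 = e + 1 := by omega
  have h2 : 8 * (e + 2) - 13 = 8 * e + 3 := by omega
  have h3 : 2 * (e + 2) - 2 = 2 * e + 2 := by omega
  have h4 : 2 * (e + 2) - 4 = 2 * e := by omega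
  rw [h1, h2, h3, h4]
  ring

end Summit.CriticalPhenomena.PercolationContinuityZ3.Theorems.Pcint
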